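import Mathlib
import HarnessLib.Audit
import Summits.PneNP.PneNP.Theorems.PstarCleanBridge
import Summits.PneNP.PneNP.Theorems.PstarGSat

/-!
# No additive split of a terminal core; separated XOR parts are evenly read (ROUND-24, O1; all core sizes; memo g25 §40)

FRONTIER range-avoidance ladder, rung F-N3, ROUND 24 (cell `pnp-ideate`, prover-2 memo `g25/O1-XORSPLIT-g25.md` §40; typed targets
`PstarCoreBoundTargets.TerminalFive` / `TerminalPeelable` (p646951); restricted-model proof complexity — nothing here bears on `P` versus `NP`).

After `PstarCleanBridge.false_of_clean_bridge` and `PstarCleanCutAssembly.false_of_cleanCut_two` the one structural unknown of the O1 chain is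
the XOR-DISCONNECTED terminal core: `K = A ⊔ B` with no XOR vertex in common (a vertex cut crossed by NO member).  This file proves the two
unconditional facts about such splittings.

* **`false_of_additive_split`** (all `k`, no induction hypothesis).  Let `(K; w₁, w₂)` be terminal and `K = A ∪ B` with `A, B` non-empty.  If
  there is a set `P` of variables containing every variable of every member of `A` and no variable of any member of `B`, such that every monomial
  of `w₁, w₂` has both AND variables in `P` or both outside `P` — no shared literal across the cut and no gate / gadget chain joining the two
  sides — then `False`.  Proof: glue `Sol(A)` (a condition on `P`) with `Sol(B)` (a condition off `P`) by `Finset.piecewise`; the readers split as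
  `wᵢ = Fᵢ(z|P) ⊕ Qᵢ(z|Pᶜ)`; by `PstarGSat.gSat` a value avoided by a G-constraint on `Sol(J)` is avoided everywhere (`gval_ne_of_ne_on_sol`),
  applied to `F₁, F₂, F₁ ⊕ F₂` over `A` and to `Q₁, Q₂` over `B`; an `𝔽₂²` case analysis against the (T3)/(M0) witnesses finishes.
  Corollary `false_of_split_ungated`: if `A` and `B` share no variable and no monomial has exactly one AND variable among the variables of `B`
  (the side `B` is UNGATED), the core is not terminal — so in an XOR-disconnected terminal core without a shared literal BOTH sides are gated.
* **`gval_xflip_part`** (all `k`).  For any `S ⊆ K` whose XOR vertices meet no XOR slot of `K ∖ S` (a union of XOR-components), both readers are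
  invariant under flipping every XOR vertex of `S`: each separated part is read EVENLY by `C₁` and by `C₂` (the flip preserves `Sol(K)` and shifts
  the readers by constants; a non-zero shift makes one combination `w₂ / w₁ / w₁ ⊕ w₂` avoid its target on `Sol(K)`, hence everywhere — against
  the (M0) witnesses).
-/

set_option linter.dupNamespace false -- `Summit.PneNP.PneNP.…`: summit = sub-problem name (D-0017 single-conjunct layout)

open Finset Literature.Computability.Complexity
open scoped symmDiff
open Summit.PneNP.PneNP.Theorems.PstarFibrePolys (bit bit_injective bit_xor bit_and)
open Summit.PneNP.PneNP.Theorems.PstarTyped (Typed)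
open Summit.PneNP.PneNP.Theorems.PstarSALevel (varSet bdry BoundaryExpanding SimpleOverlap)
open Summit.PneNP.PneNP.Theorems.PstarXCore (xpair mem_xpair xverts)
open Summit.PneNP.PneNP.Theorems.PstarGapPeeling (eval_pure feasible_of_boundaryExpanding)
open Summit.PneNP.PneNP.Theorems.PstarGapOneAll (gval)
open Summit.PneNP.PneNP.Theorems.PstarGConstraint (bit_gval)
open Summit.PneNP.PneNP.Theorems.PstarGSystemFreeVar (gval_symmDiff)
open Summit.PneNP.PneNP.Theorems.PstarGSat (gSat)
open Summit.PneNP.PneNP.Theorems.PstarCoreBoundTargets (Terminal)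
open Summit.PneNP.PneNP.Theorems.PstarChordBridgeExchange (mem_xverts_iff)
open Summit.PneNP.PneNP.Theorems.PstarChordReadFibre (symmDiff_subset_union')
open Summit.PneNP.PneNP.Theorems.PstarNoFreeVertex (vars_mem_xpair)
open Summit.PneNP.PneNP.Theorems.PstarCleanBridge (xflip exists_shift_gval_xflip eval_xflip_of_iff)

namespace Summit.PneNP.PneNP.Theorems.PstarAdditiveSplit

variable {n m : ℕ}

/-! ## A value avoided on `Sol(J)` is avoided everywhere -/

/-- **Lemma S.**  On a pure typed `(r,3/2)`-expanding instance with simple overlaps, for `#J ≤ r` and a G-constraint `(C, G)` with monomials off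
`J`: if `gval C G ≠ c` on every solution of `J`, then `gval C G ≠ c` everywhere.  (`GSat`: a non-constant G-constraint meets `Sol(J)` at both
values; a constant one takes its `Sol(J)`-value everywhere, `J` being feasible.) -/
theorem gval_ne_of_ne_on_sol (I : LocalMap 4 n m) (hI : I.IsPure xorAndPred) (hT : Typed I) (hS : SimpleOverlap I) {r : ℕ}
    (hB : BoundaryExpanding r I) (y : Fin m → Bool) {J G : Finset (Fin m)} {C : Finset (Fin n)} (hJr : J.card ≤ r)
    (hJG : Disjoint J G) {c : Bool} (h : ∀ z : Fin n → Bool, (∀ j ∈ J, I.eval z j = y j) → gval I C G z ≠ c) :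
    ∀ z : Fin n → Bool, gval I C G z ≠ c := by
  intro z hz
  by_cases hnc : ∃ z z' : Fin n → Bool, gval I C G z ≠ gval I C G z'
  · obtain ⟨z₁, hz₁, hc₁⟩ := gSat n m r I hI hT hB hS y J G C c hJr hJG hnc
    exact h z₁ hz₁ hc₁
  · push Not at hnc
    obtain ⟨z₀, hz₀⟩ := feasible_of_boundaryExpanding I hI hB y J hJr
    exact h z₀ hz₀ ((hnc z₀ z).trans hz)

/-! ## Dependence of outputs and readers on their variables; splitting a reader along a variable set -/

/-- `I.eval z j` depends only on the values of `z` on the four variables of `j`. -/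
theorem eval_congr (I : LocalMap 4 n m) (hI : I.IsPure xorAndPred) {z z' : Fin n → Bool} {j : Fin m}
    (h : ∀ s : Fin 4, z (I.vars j s) = z' (I.vars j s)) : I.eval z j = I.eval z' j := by
  rw [eval_pure I hI, eval_pure I hI, h 0, h 1, h 2, h 3]

/-- `gval C G z` depends only on the values of `z` on `C` and on the AND pairs of `G`. -/
theorem gval_congr (I : LocalMap 4 n m) {C : Finset (Fin n)} {G : Finset (Fin m)} {z z' : Fin n → Bool}
    (hC : ∀ v ∈ C, z v = z' v) (hG : ∀ g ∈ G, z (I.vars g 2) = z' (I.vars g 2) ∧ z (I.vars g 3) = z' (I.vars g 3)) :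
    gval I C G z = gval I C G z' := by
  apply bit_injective
  rw [bit_gval, bit_gval]
  congr 1
  · exact sum_congr rfl fun v hv => by rw [hC v hv]
  · exact sum_congr rfl fun g hg => by rw [(hG g hg).1, (hG g hg).2]

/-- **Splitting a reader along a variable set `P`**: `gval C G = gval C|P G|P ⊕ gval C|Pᶜ G|Pᶜ`, the monomials sorted by their first AND slot. -/
theorem gval_split (I : LocalMap 4 n m) (P C : Finset (Fin n)) (G : Finset (Fin m)) (z : Fin n → Bool) :
    gval I C G z = xor (gval I (C.filter (· ∈ P)) (G.filter fun g => I.vars g 2 ∈ P) z)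
      (gval I (C.filter (· ∉ P)) (G.filter fun g => I.vars g 2 ∉ P) z) := by
  apply bit_injective
  rw [bit_xor, bit_gval, bit_gval, bit_gval, ← sum_filter_add_sum_filter_not C (· ∈ P),
    ← sum_filter_add_sum_filter_not G (fun g => I.vars g 2 ∈ P)]
  ring

/-- The `𝔽₂²` bookkeeping of the additive split: three points of `Sol(A)` realise `(v₁, ¬v₂)`, `(¬v₁, v₂)`, `(¬v₁, ¬v₂)` and none of them may be
completed to the target by the `B`-part `(Q₁, Q₂)`; hence the `B`-part is pinned to `(b₁ ⊕ v₁, b₂ ⊕ v₂)`. -/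
theorem pin_of_three : ∀ (Q₁ Q₂ v₁ v₂ b₁ b₂ : Bool), ¬ (xor v₁ Q₁ = b₁ ∧ xor (!v₂) Q₂ = b₂) →
    ¬ (xor (!v₁) Q₁ = b₁ ∧ xor v₂ Q₂ = b₂) → ¬ (xor (!v₁) Q₁ = b₁ ∧ xor (!v₂) Q₂ = b₂) → Q₁ = xor b₁ v₁ ∧ Q₂ = xor b₂ v₂ := by
  decide

variable {I : LocalMap 4 n m} {r : ℕ} {y : Fin m → Bool} {K : Finset (Fin m)} {w₁ w₂ : Finset (Fin n) × Finset (Fin m) × Bool}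

/-! ## No additive split -/

/-- **NO ADDITIVE SPLIT OF A TERMINAL CORE** (all core sizes, unconditional).  In a terminal core `(K; w₁, w₂)` of a pure typed `(r,3/2)`-expanding
instance with simple overlaps, `K = A ∪ B` with `A, B` non-empty cannot be separated by a variable set `P` — every variable of every member of `A`
in `P`, no variable of a member of `B` in `P` — such that every monomial of `w₁, w₂` has both AND variables in `P` or both outside `P`.
In particular an XOR-disconnected terminal core needs a shared AND literal across the cut or a chain of reader monomials joining the two sides. -/
theorem false_of_additive_split (hI : I.IsPure xorAndPred) (hT : Typed I) (hS : SimpleOverlap I) (hB : BoundaryExpanding r I)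
    (ht : Terminal I r y K w₁ w₂) {A B : Finset (Fin m)} (hAB : A ∪ B = K) (hA : A.Nonempty) (hBn : B.Nonempty)
    (P : Finset (Fin n)) (hAP : ∀ j ∈ A, ∀ s : Fin 4, I.vars j s ∈ P) (hBP : ∀ j ∈ B, ∀ s : Fin 4, I.vars j s ∉ P)
    (hmono : ∀ g ∈ w₁.2.1 ∪ w₂.2.1, (I.vars g 2 ∈ P ↔ I.vars g 3 ∈ P)) : False := by
  classical
  obtain ⟨-, -, hKr, hd₁, hd₂, -, hT3, hM0⟩ := ht
  have hAK : A ⊆ K := by rw [← hAB]; exact subset_union_left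
  have hBK : B ⊆ K := by rw [← hAB]; exact subset_union_right
  have hAr : A.card ≤ r := (card_le_card hAK).trans hKr.le
  have hBr : B.card ≤ r := (card_le_card hBK).trans hKr.le
  have hd : Disjoint K (w₁.2.1 ∪ w₂.2.1) := disjoint_union_right.2 ⟨hd₁, hd₂⟩
  have hAB' : ∀ j ∈ A, j ∉ B := fun j hjA hjB => hBP j hjB 0 (hAP j hjA 0)
  -- the `P`-parts `F` and the `Pᶜ`-parts `Q` of the readers
  set F₁C := w₁.1.filter (· ∈ P) with hF₁C
  set F₁G := w₁.2.1.filter fun g => I.vars g 2 ∈ P with hF₁G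
  set Q₁C := w₁.1.filter (· ∉ P) with hQ₁C
  set Q₁G := w₁.2.1.filter fun g => I.vars g 2 ∉ P with hQ₁G
  set F₂C := w₂.1.filter (· ∈ P) with hF₂C
  set F₂G := w₂.2.1.filter fun g => I.vars g 2 ∈ P with hF₂G
  set Q₂C := w₂.1.filter (· ∉ P) with hQ₂C
  set Q₂G := w₂.2.1.filter fun g => I.vars g 2 ∉ P with hQ₂G
  set f₁ : (Fin n → Bool) → Bool := fun z => gval I F₁C F₁G z with hf₁
  set f₂ : (Fin n → Bool) → Bool := fun z => gval I F₂C F₂G z with hf₂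
  set q₁ : (Fin n → Bool) → Bool := fun z => gval I Q₁C Q₁G z with hq₁
  set q₂ : (Fin n → Bool) → Bool := fun z => gval I Q₂C Q₂G z with hq₂
  have split₁ : ∀ z, gval I w₁.1 w₁.2.1 z = xor (f₁ z) (q₁ z) := fun z => gval_split I P _ _ z
  have split₂ : ∀ z, gval I w₂.1 w₂.2.1 z = xor (f₂ z) (q₂ z) := fun z => gval_split I P _ _ z
  have sF₁G : F₁G ⊆ w₁.2.1 ∪ w₂.2.1 := (filter_subset _ _).trans subset_union_left
  have sF₂G : F₂G ⊆ w₁.2.1 ∪ w₂.2.1 := (filter_subset _ _).trans subset_union_right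
  have sQ₁G : Q₁G ⊆ w₁.2.1 ∪ w₂.2.1 := (filter_subset _ _).trans subset_union_left
  have sQ₂G : Q₂G ⊆ w₁.2.1 ∪ w₂.2.1 := (filter_subset _ _).trans subset_union_right
  have dA : ∀ {G : Finset (Fin m)}, G ⊆ w₁.2.1 ∪ w₂.2.1 → Disjoint A G := fun hG => (hd.mono_left hAK).mono_right hG
  have dB : ∀ {G : Finset (Fin m)}, G ⊆ w₁.2.1 ∪ w₂.2.1 → Disjoint B G := fun hG => (hd.mono_left hBK).mono_right hG
  -- gluing: `A` and the `F`-parts live on `P`, `B` and the `Q`-parts off `P`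
  have glueA : ∀ z z', (∀ j ∈ A, I.eval z j = y j) → ∀ j ∈ A, I.eval (P.piecewise z z') j = y j := by
    intro z z' hz j hj
    rw [eval_congr I hI (z' := z) fun s => Finset.piecewise_eq_of_mem _ _ _ (hAP j hj s)]
    exact hz j hj
  have glueB : ∀ z z', (∀ j ∈ B, I.eval z' j = y j) → ∀ j ∈ B, I.eval (P.piecewise z z') j = y j := by
    intro z z' hz' j hj
    rw [eval_congr I hI (z' := z') fun s => Finset.piecewise_eq_of_notMem _ _ _ (hBP j hj s)]
    exact hz' j hj
  have glueF : ∀ (C : Finset (Fin n)) (G : Finset (Fin m)), G ⊆ w₁.2.1 ∪ w₂.2.1 → ∀ z z',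
      gval I (C.filter (· ∈ P)) (G.filter fun g => I.vars g 2 ∈ P) (P.piecewise z z') =
        gval I (C.filter (· ∈ P)) (G.filter fun g => I.vars g 2 ∈ P) z := by
    intro C G hG z z'
    refine gval_congr I (fun v hv => Finset.piecewise_eq_of_mem _ _ _ (mem_filter.1 hv).2) fun g hg => ?_
    obtain ⟨hgG, h2⟩ := mem_filter.1 hg
    exact ⟨Finset.piecewise_eq_of_mem _ _ _ h2, Finset.piecewise_eq_of_mem _ _ _ ((hmono g (hG hgG)).1 h2)⟩
  have glueQ : ∀ (C : Finset (Fin n)) (G : Finset (Fin m)), G ⊆ w₁.2.1 ∪ w₂.2.1 → ∀ z z',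
      gval I (C.filter (· ∉ P)) (G.filter fun g => I.vars g 2 ∉ P) (P.piecewise z z') =
        gval I (C.filter (· ∉ P)) (G.filter fun g => I.vars g 2 ∉ P) z' := by
    intro C G hG z z'
    refine gval_congr I (fun v hv => Finset.piecewise_eq_of_notMem _ _ _ (mem_filter.1 hv).2) fun g hg => ?_
    obtain ⟨hgG, h2⟩ := mem_filter.1 hg
    exact ⟨Finset.piecewise_eq_of_notMem _ _ _ h2, Finset.piecewise_eq_of_notMem _ _ _ fun h3 => h2 ((hmono g (hG hgG)).2 h3)⟩
  -- (T): no solution of `A` and solution of `B` complete each other to the target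
  have T : ∀ zA zB : Fin n → Bool, (∀ j ∈ A, I.eval zA j = y j) → (∀ j ∈ B, I.eval zB j = y j) →
      ¬ (xor (f₁ zA) (q₁ zB) = w₁.2.2 ∧ xor (f₂ zA) (q₂ zB) = w₂.2.2) := by
    rintro zA zB hzA hzB ⟨h₁, h₂⟩
    refine hT3 ⟨P.piecewise zA zB, fun j hj => ?_, ?_, ?_⟩
    · rw [← hAB, mem_union] at hj
      rcases hj with hj | hj
      · exact glueA zA zB hzA j hj
      · exact glueB zA zB hzB j hj
    · rw [split₁]
      change xor (gval I F₁C F₁G (P.piecewise zA zB)) (gval I Q₁C Q₁G (P.piecewise zA zB)) = w₁.2.2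
      rw [hF₁C, hF₁G, hQ₁C, hQ₁G, glueF _ _ subset_union_left, glueQ _ _ subset_union_left]
      exact h₁
    · rw [split₂]
      change xor (gval I F₂C F₂G (P.piecewise zA zB)) (gval I Q₂C Q₂G (P.piecewise zA zB)) = w₂.2.2
      rw [hF₂C, hF₂G, hQ₂C, hQ₂G, glueF _ _ subset_union_right, glueQ _ _ subset_union_right]
      exact h₂
  -- (M0) witnesses: one solving `B` (delete a member of `A`), one solving `A` (delete a member of `B`), both on target
  obtain ⟨a, ha⟩ := hA
  obtain ⟨b, hb⟩ := hBn
  obtain ⟨zB, hzB', hzB₁, hzB₂⟩ := hM0 a (hAK ha)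
  obtain ⟨zA, hzA', hzA₁, hzA₂⟩ := hM0 b (hBK hb)
  have hzB : ∀ j ∈ B, I.eval zB j = y j := fun j hj => hzB' j (mem_erase.2 ⟨fun h => hAB' a ha (by rw [← h]; exact hj), hBK hj⟩)
  have hzA : ∀ j ∈ A, I.eval zA j = y j := fun j hj => hzA' j (mem_erase.2 ⟨fun h => hAB' j hj (by rw [h]; exact hb), hAK hj⟩)
  rw [split₁] at hzB₁ hzA₁
  rw [split₂] at hzB₂ hzA₂
  -- the values `v = F(zB)`; no solution of `A` realises `v`
  set v₁ := f₁ zB with hv₁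
  set v₂ := f₂ zB with hv₂
  clear_value v₁ v₂
  have nohit : ∀ z, (∀ j ∈ A, I.eval z j = y j) → ¬ (f₁ z = v₁ ∧ f₂ z = v₂) := by
    rintro z hz ⟨h₁, h₂⟩
    exact T z zB hz hzB ⟨by rw [h₁]; exact hzB₁, by rw [h₂]; exact hzB₂⟩
  -- Lemma S for `F₁`, `F₂`, `F₁ ⊕ F₂` over `A`: each hits its `zB`-value on `Sol(A)`
  have S₁ : ∃ z, (∀ j ∈ A, I.eval z j = y j) ∧ f₁ z = v₁ := by
    by_contra h
    push Not at h
    exact gval_ne_of_ne_on_sol I hI hT hS hB y hAr (dA sF₁G) h zB hv₁.symm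
  have S₂ : ∃ z, (∀ j ∈ A, I.eval z j = y j) ∧ f₂ z = v₂ := by
    by_contra h
    push Not at h
    exact gval_ne_of_ne_on_sol I hI hT hS hB y hAr (dA sF₂G) h zB hv₂.symm
  have S₃ : ∃ z, (∀ j ∈ A, I.eval z j = y j) ∧ xor (f₁ z) (f₂ z) = xor v₁ v₂ := by
    by_contra h
    push Not at h
    have h' : ∀ z, (∀ j ∈ A, I.eval z j = y j) → gval I (F₁C ∆ F₂C) (F₁G ∆ F₂G) z ≠ xor v₁ v₂ := by
      intro z hz; rw [gval_symmDiff]; exact h z hz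
    refine gval_ne_of_ne_on_sol I hI hT hS hB y hAr (dA ((symmDiff_subset_union' F₁G F₂G).trans (union_subset sF₁G sF₂G))) h' zB ?_
    rw [gval_symmDiff, hv₁, hv₂]
  obtain ⟨z₁, hz₁, hf₁⟩ := S₁
  obtain ⟨z₂, hz₂, hf₂⟩ := S₂
  obtain ⟨z₃, hz₃, hf₃⟩ := S₃
  have hg₁ : f₂ z₁ = !v₂ := by
    have := nohit z₁ hz₁
    revert this hf₁; cases f₁ z₁ <;> cases f₂ z₁ <;> cases v₁ <;> cases v₂ <;> decide
  have hg₂ : f₁ z₂ = !v₁ := by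
    have := nohit z₂ hz₂
    revert this hf₂; cases f₁ z₂ <;> cases f₂ z₂ <;> cases v₁ <;> cases v₂ <;> decide
  have hg₃ : f₁ z₃ = !v₁ ∧ f₂ z₃ = !v₂ := by
    have := nohit z₃ hz₃
    revert this hf₃; cases f₁ z₃ <;> cases f₂ z₃ <;> cases v₁ <;> cases v₂ <;> decide
  -- hence the `Q`-part is pinned on `Sol(B)`, so everywhere (Lemma S over `B`), in particular at `zA`
  have pin : ∀ z, (∀ j ∈ B, I.eval z j = y j) → q₁ z = xor w₁.2.2 v₁ ∧ q₂ z = xor w₂.2.2 v₂ := by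
    intro z hz
    refine pin_of_three (q₁ z) (q₂ z) v₁ v₂ w₁.2.2 w₂.2.2 ?_ ?_ ?_
    · have := T z₁ z hz₁ hz; rwa [hf₁, hg₁] at this
    · have := T z₂ z hz₂ hz; rwa [hg₂, hf₂] at this
    · have := T z₃ z hz₃ hz; rwa [hg₃.1, hg₃.2] at this
  have pin₁ : q₁ zA = xor w₁.2.2 v₁ := by
    have h : ∀ z, (∀ j ∈ B, I.eval z j = y j) → gval I Q₁C Q₁G z ≠ !(xor w₁.2.2 v₁) := by
      intro z hz; rw [show gval I Q₁C Q₁G z = q₁ z from rfl, (pin z hz).1]; cases xor w₁.2.2 v₁ <;> decide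
    have := gval_ne_of_ne_on_sol I hI hT hS hB y hBr (dB sQ₁G) h zA
    revert this; change q₁ zA ≠ !(xor w₁.2.2 v₁) → _; cases q₁ zA <;> cases xor w₁.2.2 v₁ <;> decide
  have pin₂ : q₂ zA = xor w₂.2.2 v₂ := by
    have h : ∀ z, (∀ j ∈ B, I.eval z j = y j) → gval I Q₂C Q₂G z ≠ !(xor w₂.2.2 v₂) := by
      intro z hz; rw [show gval I Q₂C Q₂G z = q₂ z from rfl, (pin z hz).2]; cases xor w₂.2.2 v₂ <;> decide
    have := gval_ne_of_ne_on_sol I hI hT hS hB y hBr (dB sQ₂G) h zA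
    revert this; change q₂ zA ≠ !(xor w₂.2.2 v₂) → _; cases q₂ zA <;> cases xor w₂.2.2 v₂ <;> decide
  -- but `zA ∈ Sol(A)` is on target: `F(zA) = v`
  refine nohit zA hzA ⟨?_, ?_⟩
  · rw [pin₁] at hzA₁; revert hzA₁; cases f₁ zA <;> cases w₁.2.2 <;> cases v₁ <;> decide
  · rw [pin₂] at hzA₂; revert hzA₂; cases f₂ zA <;> cases w₂.2.2 <;> cases v₂ <;> decide

/-- **Corollary: an UNGATED side is impossible.**  If `K = A ∪ B` (both non-empty), no member of `A` shares a variable with a member of `B`, and no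
monomial of the readers has exactly one AND variable among the variables of `B`, the core is not terminal.  (Take `P` = the complement of the
variables of `B`.)  So in an XOR-disconnected terminal core without a shared literal, each side carries a monomial gating it to the outside. -/
theorem false_of_split_ungated (hI : I.IsPure xorAndPred) (hT : Typed I) (hS : SimpleOverlap I) (hB : BoundaryExpanding r I)
    (ht : Terminal I r y K w₁ w₂) {A B : Finset (Fin m)} (hAB : A ∪ B = K) (hA : A.Nonempty) (hBn : B.Nonempty)
    (hsh : ∀ j ∈ A, ∀ j' ∈ B, ∀ s s' : Fin 4, I.vars j s ≠ I.vars j' s')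
    (hung : ∀ g ∈ w₁.2.1 ∪ w₂.2.1, ((∃ j ∈ B, ∃ s : Fin 4, I.vars g 2 = I.vars j s) ↔ (∃ j ∈ B, ∃ s : Fin 4, I.vars g 3 = I.vars j s))) :
    False := by
  classical
  set P : Finset (Fin n) := univ.filter fun v => ¬ ∃ j ∈ B, ∃ s : Fin 4, v = I.vars j s with hP
  have memP : ∀ v, v ∈ P ↔ ¬ ∃ j ∈ B, ∃ s : Fin 4, v = I.vars j s := fun v => by
    rw [hP, mem_filter]; simp only [mem_univ, true_and]
  refine false_of_additive_split hI hT hS hB ht hAB hA hBn P (fun j hj s => ?_) (fun j hj s => ?_) fun g hg => ?_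
  · rw [memP]
    rintro ⟨j', hj', s', h⟩
    exact hsh j hj j' hj' s s' h
  · rw [memP, not_not]
    exact ⟨j, hj, s, rfl⟩
  · rw [memP, memP, not_iff_not]
    exact hung g hg

/-! ## Separated XOR parts are evenly read -/

/-- **THE READERS ARE INVARIANT UNDER FLIPPING A SEPARATED XOR PART** (all core sizes, unconditional).  In a terminal core `(K; w₁, w₂)`, for every
`S ⊆ K` whose XOR vertices carry no XOR slot of a member outside `S` (a union of XOR-components of `K`), flipping every XOR vertex of `S` changes
neither reader: `C₁` and `C₂` each meet `xverts S` in an even number of vertices. -/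
theorem gval_xflip_part (hI : I.IsPure xorAndPred) (hT : Typed I) (hS : SimpleOverlap I) (hB : BoundaryExpanding r I)
    (ht : Terminal I r y K w₁ w₂) {S : Finset (Fin m)}
    (hsep : ∀ f ∈ K, f ∉ S → I.vars f 0 ∉ xverts I S ∧ I.vars f 1 ∉ xverts I S) :
    (∀ x, gval I w₁.1 w₁.2.1 (xflip (xverts I S) x) = gval I w₁.1 w₁.2.1 x) ∧
      (∀ x, gval I w₂.1 w₂.2.1 (xflip (xverts I S) x) = gval I w₂.1 w₂.2.1 x) := by
  classical
  obtain ⟨hne, -, hKr, hd₁, hd₂, -, hT3, hM0⟩ := ht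
  have T := fun (z : Fin n → Bool) (hz : ∀ j ∈ K, I.eval z j = y j) (h₁ : gval I w₁.1 w₁.2.1 z = w₁.2.2)
    (h₂ : gval I w₂.1 w₂.2.1 z = w₂.2.2) => hT3 ⟨z, hz, h₁, h₂⟩
  -- AND variables avoid the XOR vertices of `S` (typed)
  have hSand : ∀ v ∈ xverts I S, ∀ g : Fin m, I.vars g 2 ≠ v ∧ I.vars g 3 ≠ v := by
    intro v hv g
    obtain ⟨j, -, hvj⟩ := (mem_xverts_iff I S v).1 hv
    rcases (mem_xpair I).1 hvj with h | h
    · exact ⟨fun e' => hT j g 0 2 (by decide) (by decide) (h ▸ e'.symm), fun e' => hT j g 0 3 (by decide) (by decide) (h ▸ e'.symm)⟩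
    · exact ⟨fun e' => hT j g 1 2 (by decide) (by decide) (h ▸ e'.symm), fun e' => hT j g 1 3 (by decide) (by decide) (h ▸ e'.symm)⟩
  have hAnd : ∀ g : Fin m, I.vars g 2 ∉ xverts I S ∧ I.vars g 3 ∉ xverts I S :=
    fun g => ⟨fun h => (hSand _ h g).1 rfl, fun h => (hSand _ h g).2 rfl⟩
  -- every member of `K` is preserved by the flip
  have keep : ∀ f ∈ K, ∀ x, I.eval (xflip (xverts I S) x) f = I.eval x f := by
    intro f hf x
    refine eval_xflip_of_iff I hI (hAnd f).1 (hAnd f).2 ?_ x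
    by_cases hfS : f ∈ S
    · exact ⟨fun _ => (mem_xverts_iff I S _).2 ⟨f, hfS, vars_mem_xpair f (s := 1) (by decide)⟩,
        fun _ => (mem_xverts_iff I S _).2 ⟨f, hfS, vars_mem_xpair f (s := 0) (by decide)⟩⟩
    · exact ⟨fun h => absurd h (hsep f hf hfS).1, fun h => absurd h (hsep f hf hfS).2⟩
  have solK : ∀ z, (∀ j ∈ K, I.eval z j = y j) → ∀ j ∈ K, I.eval (xflip (xverts I S) z) j = y j :=
    fun z hz j hj => by rw [keep j hj]; exact hz j hj
  obtain ⟨ε₁, hε₁⟩ := exists_shift_gval_xflip I hI w₁.1 w₁.2.1 (xverts I S) fun v hv g _ => hSand v hv g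
  obtain ⟨ε₂, hε₂⟩ := exists_shift_gval_xflip I hI w₂.1 w₂.2.1 (xverts I S) fun v hv g _ => hSand v hv g
  -- an (M0) witness, on target for both readers
  obtain ⟨f, hf⟩ := hne
  obtain ⟨w, -, hw₁, hw₂⟩ := hM0 f hf
  suffices h0 : ε₁ = false ∧ ε₂ = false by
    obtain ⟨h1, h2⟩ := h0
    subst h1 h2
    exact ⟨fun x => by rw [hε₁, Bool.xor_false], fun x => by rw [hε₂, Bool.xor_false]⟩
  by_contra hε
  have hd : Disjoint K (w₁.2.1 ∪ w₂.2.1) := disjoint_union_right.2 ⟨hd₁, hd₂⟩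
  rcases Bool.eq_false_or_eq_true ε₁ with e₁ | e₁ <;> rcases Bool.eq_false_or_eq_true ε₂ with e₂ | e₂
  · -- both readers shift: `w₁ ⊕ w₂` avoids `b₁ ⊕ b₂` on `Sol(K)`
    have h : ∀ z, (∀ j ∈ K, I.eval z j = y j) → gval I (w₁.1 ∆ w₂.1) (w₁.2.1 ∆ w₂.2.1) z ≠ xor w₁.2.2 w₂.2.2 := by
      intro z hz hz12
      rw [gval_symmDiff] at hz12
      by_cases h₁ : gval I w₁.1 w₁.2.1 z = w₁.2.2
      · refine T z hz h₁ ?_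
        rw [h₁] at hz12; revert hz12; cases gval I w₂.1 w₂.2.1 z <;> cases w₁.2.2 <;> cases w₂.2.2 <;> decide
      · refine T _ (solK z hz) ?_ ?_
        · rw [hε₁, e₁]; revert h₁; cases gval I w₁.1 w₁.2.1 z <;> cases w₁.2.2 <;> decide
        · rw [hε₂, e₂]; revert h₁ hz12
          cases gval I w₁.1 w₁.2.1 z <;> cases gval I w₂.1 w₂.2.1 z <;> cases w₁.2.2 <;> cases w₂.2.2 <;> decide
    refine gval_ne_of_ne_on_sol I hI hT hS hB y hKr.le (hd.mono_right (symmDiff_subset_union' _ _)) h w ?_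
    rw [gval_symmDiff, hw₁, hw₂]
  · -- only `w₁` shifts: `w₂` avoids `b₂` on `Sol(K)`
    have h : ∀ z, (∀ j ∈ K, I.eval z j = y j) → gval I w₂.1 w₂.2.1 z ≠ w₂.2.2 := by
      intro z hz h₂
      by_cases h₁ : gval I w₁.1 w₁.2.1 z = w₁.2.2
      · exact T z hz h₁ h₂
      · refine T _ (solK z hz) ?_ ?_
        · rw [hε₁, e₁]; revert h₁; cases gval I w₁.1 w₁.2.1 z <;> cases w₁.2.2 <;> decide
        · rw [hε₂, e₂, h₂, Bool.xor_false]
    exact gval_ne_of_ne_on_sol I hI hT hS hB y hKr.le hd₂ h w hw₂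
  · -- only `w₂` shifts: `w₁` avoids `b₁` on `Sol(K)`
    have h : ∀ z, (∀ j ∈ K, I.eval z j = y j) → gval I w₁.1 w₁.2.1 z ≠ w₁.2.2 := by
      intro z hz h₁
      by_cases h₂ : gval I w₂.1 w₂.2.1 z = w₂.2.2
      · exact T z hz h₁ h₂
      · refine T _ (solK z hz) ?_ ?_
        · rw [hε₁, e₁, h₁, Bool.xor_false]
        · rw [hε₂, e₂]; revert h₂; cases gval I w₂.1 w₂.2.1 z <;> cases w₂.2.2 <;> decide
    exact gval_ne_of_ne_on_sol I hI hT hS hB y hKr.le hd₁ h w hw₁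
  · exact hε ⟨e₁, e₂⟩

end Summit.PneNP.PneNP.Theorems.PstarAdditiveSplit
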